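import Mathlib
import HarnessLib
import Summits.NavierStokesRegularity.NavierStokesRegularity.Theorems.TaylorModelRungThreeCertificateFormat
import Summits.NavierStokesRegularity.NavierStokesRegularity.Theorems.TaylorModelRungThreeCertificateSoundBridge
import Summits.NavierStokesRegularity.NavierStokesRegularity.Theorems.TaylorModelRungThreeCertificateSoundField
import Summits.NavierStokesRegularity.NavierStokesRegularity.Theorems.TaylorModelRungThreeReadoutCoords

/-!
# Crux K1b-DR (stmt-NavierStokesRegularity-23954), line `taylor-model` — certificate SOUNDNESS, part 3: the NODE
# clauses of `Chain` from `checkNode = true`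

`CertTables.node_of_checkNode`: for an exact ordered field `K`, a MONOTONE ring map `φ : K →+* ℝ`, tables `T` with
`CoefOK φ T`, and a node `(j, s)` with `T.checkNode j s = true`, the interpreted record `d := T.toCertData φ` satisfies
the twenty per-node clauses a1–a20 of `TaylorChain.CertData.Chain` at `(j, s)` VERBATIM: window support of the centre
and the jets (by construction), `0 ≤ mC`, `|x| ≤ mC ω`, `rP ≥ 0`, the level order `0 ≤ EI ≤ E ≤ EO ≤ ρO`,
`E ≤ ρ ≤ ρO`, linearity and window support of the frames, the EXACT frame inverses on window vectors (from the two
matrix identities), the two parallelepiped bounds and the `NCi` bound (from weighted row sums), `P 0 = x`, the jet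
recursion (from the exact vector identities, via the field bridge `Qb_vecR`), `Wv 0 = trunc`, and the variational-jet
recursion (from the exact matrix identities, via `linR_symQbMat`). Also the order bridge (`φ |a| = |φ a|`, decided
inequalities transported) used by all later parts. CERT-CONTRACT-23954 v1 §4 (node block). MODEL-lattice rung TL-M3;
nothing here is a statement about the Navier–Stokes equations.
-/

-- the sub-problem namespace repeats the summit name by design (D-0017)
set_option linter.dupNamespace false

namespace Summit.NavierStokesRegularity.NavierStokesRegularity.Theorems.TaylorModelCert

open scoped BigOperators
open Literature.Analysis.FluidPDE.TaoCascade Literature.Analysis.FluidPDE.TaoCascade.TaylorChain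
open Summit.NavierStokesRegularity.NavierStokesRegularity.Theorems.TaylorModelReadout (trunc trunc_apply trunc_eq_self
  wsupp_Qb)

namespace CertTables

/-! ### Order bridge for a monotone ring map -/

section Order

variable {K : Type} [Field K] [LinearOrder K] [IsStrictOrderedRing K] {φ : K →+* ℝ} (hφ : Monotone φ)
include hφ

/-- A monotone ring map commutes with `|·|`. [folklore] -/
theorem map_abs (a : K) : φ |a| = |φ a| := by
  rcases le_total 0 a with ha | ha
  · rw [abs_of_nonneg ha, abs_of_nonneg (by simpa using hφ ha)]
  · rw [abs_of_nonpos ha, map_neg, abs_of_nonpos (by simpa using hφ ha)]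

omit [IsStrictOrderedRing K] in
/-- Transport of a decided `≤`. [folklore] -/
theorem le_of_decide {a b : K} (h : decide (a ≤ b) = true) : φ a ≤ φ b := hφ (of_decide_eq_true h)

omit [IsStrictOrderedRing K] in
/-- A monotone ring map out of a field is strictly monotone. [folklore] -/
theorem strictMono : StrictMono φ := hφ.strictMono_of_injective φ.injective

omit [IsStrictOrderedRing K] in
/-- Transport of a decided `<`. [folklore] -/
theorem lt_of_decide {a b : K} (h : decide (a < b) = true) : φ a < φ b := (strictMono hφ) (of_decide_eq_true h)

end Order


/-! ### Projections of `toCertData` at a node -/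

section Proj

variable {K : Type} [Field K] (φ : K →+* ℝ) (T : CertTables K) (j s : ℕ)

/-- `S` of the interpreted record. [folklore] -/
theorem toCertData_S : (T.toCertData φ).S j = (T.stage j).S := rfl
/-- `N₀` of the interpreted record. [folklore] -/
theorem toCertData_N₀ : (T.toCertData φ).N₀ = T.N₀ := rfl
/-- Centre of a node. [folklore] -/
theorem toCertData_x : (T.toCertData φ).x j s = T.vecR φ (T.node j s).x := rfl
/-- Jets of a node. [folklore] -/
theorem toCertData_P (n : ℕ) : (T.toCertData φ).P j s n = T.vecR φ ((T.node j s).P.getD n []) := rfl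
/-- Variational jets of a node. [folklore] -/
theorem toCertData_Wv (n : ℕ) : (T.toCertData φ).Wv j s n = T.linR φ ((T.node j s).W.getD n []) := rfl
/-- Frame of a node. [folklore] -/
theorem toCertData_Cm : (T.toCertData φ).Cm j s = T.linR φ (T.node j s).Cm := rfl
/-- Inverse frame of a node. [folklore] -/
theorem toCertData_Ci : (T.toCertData φ).Ci j s = T.linR φ (T.node j s).Ci := rfl
/-- Parallelepiped radii of a node. [folklore] -/
theorem toCertData_rP : (T.toCertData φ).rP j s = T.vecR φ (T.node j s).rP := rfl
/-- `mC` of a node. [folklore] -/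
theorem toCertData_mC : (T.toCertData φ).mC j s = φ (T.node j s).mC := rfl
/-- `EI` of a node. [folklore] -/
theorem toCertData_EI : (T.toCertData φ).EI j s = φ (T.node j s).EI := rfl
/-- `E` of a node. [folklore] -/
theorem toCertData_E : (T.toCertData φ).E j s = φ (T.node j s).E := rfl
/-- `EO` of a node. [folklore] -/
theorem toCertData_EO : (T.toCertData φ).EO j s = φ (T.node j s).EO := rfl
/-- `ρ` of a node. [folklore] -/
theorem toCertData_ρ : (T.toCertData φ).ρ j s = φ (T.node j s).ρ := rfl
/-- `ρO` of a node. [folklore] -/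
theorem toCertData_ρO : (T.toCertData φ).ρO j s = φ (T.node j s).ρO := rfl
/-- `NCi` of a node. [folklore] -/
theorem toCertData_NCi : (T.toCertData φ).NCi j s = φ (T.node j s).NCi := rfl

/-- Two lists with the same first `n` entries give the same table vector. [folklore] -/
theorem vecR_congr {u v : List K} (h : ∀ c < T.n, vget u c = vget v c) : T.vecR φ u = T.vecR φ v := by
  funext i k
  rw [T.vecR_apply, T.vecR_apply]
  split_ifs with hk
  · rw [h _ (T.idx_lt_n i hk)]
  · rfl

/-- `linR` of the identity matrix is the truncation. [folklore] -/
theorem linR_idMat (y : Fin 4 → ℤ → ℝ) : T.linR φ T.idMat y = trunc (T.toCertData φ) y := by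
  rw [T.trunc_eq_sum_basis φ y]
  refine T.eq_of_wv_eq (fun i k hk => T.linR_off φ _ y i hk) (fun i k hk => ?_) fun r hr => ?_
  · rw [Finset.sum_apply, Finset.sum_apply]
    exact Finset.sum_eq_zero fun c _ => by simp [T.vecR_off φ _ i hk]
  · rw [T.wv_linR φ _ y hr]
    unfold wv
    rw [Finset.sum_apply, Finset.sum_apply]
    refine Finset.sum_congr rfl fun c hc => ?_
    have hc' := Finset.mem_range.1 hc
    rw [T.mget_idMat hr hc']
    simp only [Pi.smul_apply, smul_eq_mul]
    rw [show T.vecR φ (T.basisVec c) (T.wi r) (T.wk r) = T.wv (T.vecR φ (T.basisVec c)) r from rfl, T.wv_vecR φ _ hr,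
      T.vget_basisVec hr]
    by_cases h : r = c
    · subst h; simp
    · simp [h]

/-- Entries of a `foldr`-sum of vectors. [folklore] -/
theorem vget_foldr_addVecN (N : ℕ) (g : ℕ → List K) {c : ℕ} (hc : c < T.n) :
    vget ((List.range N).foldr (fun m' acc => addVecN T.n (g m') acc) ((List.range T.n).map fun _ => (0 : K))) c =
      ∑ m' ∈ Finset.range N, vget (g m') c := by
  have key : ∀ (l : List ℕ) (B : List K), vget (l.foldr (fun m' acc => addVecN T.n (g m') acc) B) c =
      vget (l.foldr (fun m' acc => addVecN T.n (g m') acc) ((List.range T.n).map fun _ => (0 : K))) c + vget B c := by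
    intro l
    induction l with
    | nil => intro B; simp only [List.foldr_nil]; rw [vget_zeroVec hc, zero_add]
    | cons a l ihl => intro B; simp only [List.foldr_cons, vget_addVecN _ _ hc]; rw [ihl B]; ring
  induction N with
  | zero => simp only [List.range_zero, List.foldr_nil, Finset.range_zero, Finset.sum_empty]; exact vget_zeroVec hc
  | succ N ih =>
    rw [List.range_succ, List.foldr_append, List.foldr_cons, List.foldr_nil, Finset.sum_range_succ, key, ih,
      vget_addVecN _ _ hc, vget_zeroVec hc, add_zero]

/-! ### Real-input forms of the polarised field (exports for the `Readouts` / `StageNumerics` lanes) -/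

variable {φ T} in
/-- **The bilinear form `qB` through the effective-coefficient table** (real arguments, window target): under
`CoefOK`, `qB d u v i k = Σ_{a,b,μ} φ(coef a b i μ k) · trunc u_a(k-μ₃+μ₁) · trunc v_b(k-μ₃+μ₂)`. [folklore] -/
theorem qB_coef (hco : T.CoefOK φ) (u v : Fin 4 → ℤ → ℝ) (i : Fin 4) {k : ℤ} (hk : -T.Kb ≤ k ∧ k ≤ T.Ka) :
    TaylorModelReadout.qB (T.toCertData φ) u v i k =
      ∑ a : Fin 4, ∑ b : Fin 4, ∑ μi ∈ Finset.range 4, φ (T.coefAt a b i μi k) *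
        (trunc (T.toCertData φ) u a (k - (shifts.getD μi (0, 0, 0)).2.2 + (shifts.getD μi (0, 0, 0)).1) *
          trunc (T.toCertData φ) v b (k - (shifts.getD μi (0, 0, 0)).2.2 + (shifts.getD μi (0, 0, 0)).2.1)) := by
  unfold TaylorModelReadout.qB
  simp only [toCertData_Kb, toCertData_Ka, hk, and_self, ↓reduceIte]
  refine Finset.sum_congr rfl fun a _ => Finset.sum_congr rfl fun b _ => ?_
  rw [sum_shiftSet_eq]
  refine Finset.sum_congr rfl fun μi hμi => ?_
  rw [Finset.mem_range] at hμi
  rw [hco _ _ i μi k hμi hk.1 hk.2, toCertData_α, shifts_getD μi hμi, if_pos hμi]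
  norm_num

variable {φ T} in
/-- **Bilinear expansion of `Qb` in window values with checker-computable coefficients**: under `CoefOK`,
`Qb y y' = Σ_{c,c'} (wv y c · wv y' c') • vecR (QbVec e_c e_c')`. [folklore] -/
theorem Qb_eq_sum_basis (hco : T.CoefOK φ) (y y' : Fin 4 → ℤ → ℝ) :
    (T.toCertData φ).Qb y y' = ∑ c ∈ Finset.range T.n, ∑ c' ∈ Finset.range T.n,
      (T.wv y c * T.wv y' c') • T.vecR φ (T.QbVec (T.basisVec c) (T.basisVec c')) := by
  let B : (Fin 4 → ℤ → ℝ) →ₗ[ℝ] (Fin 4 → ℤ → ℝ) →ₗ[ℝ] (Fin 4 → ℤ → ℝ) :=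
    LinearMap.mk₂ ℝ (T.toCertData φ).Qb (TaylorModelReadout.Qb_add_left _) (TaylorModelReadout.Qb_smul_left _)
      (TaylorModelReadout.Qb_add_right _) (TaylorModelReadout.Qb_smul_right _)
  have hB : ∀ u v, (T.toCertData φ).Qb u v = B u v := fun _ _ => rfl
  rw [← TaylorModelReadout.Qb_trunc, T.trunc_eq_sum_basis φ y, T.trunc_eq_sum_basis φ y', hB, LinearMap.map_sum₂]
  refine Finset.sum_congr rfl fun c _ => ?_
  rw [map_sum]
  refine Finset.sum_congr rfl fun c' _ => ?_
  rw [LinearMap.map_smul₂, map_smul, ← hB, T.Qb_vecR hco, smul_smul]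

end Proj

/-! ### The node clauses -/

section Node

variable {K : Type} [Field K] [LinearOrder K] [IsStrictOrderedRing K] {φ : K →+* ℝ} (hφ : Monotone φ)
  (T : CertTables K)
include hφ

/-- Weighted row sums bound the window values of `linR A y`. [folklore] -/
theorem abs_wv_linR_le {A : List (List K)} {wIn bound : ℕ → K} (h : T.rowSumLe A wIn bound = true)
    {y : Fin 4 → ℤ → ℝ} (hy : ∀ c < T.n, |T.wv y c| ≤ φ (wIn c)) {r : ℕ} (hr : r < T.n) :
    |T.wv (T.linR φ A y) r| ≤ φ (bound r) := by
  rw [T.wv_linR φ A y hr]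
  have hrow := (T.rowSumLe_eq_true.1 h) r hr
  calc |∑ c ∈ Finset.range T.n, φ (mget A r c) * T.wv y c|
      ≤ ∑ c ∈ Finset.range T.n, |φ (mget A r c) * T.wv y c| := Finset.abs_sum_le_sum_abs _ _
    _ ≤ ∑ c ∈ Finset.range T.n, |φ (mget A r c)| * φ (wIn c) := by
        refine Finset.sum_le_sum fun c hc => ?_
        rw [abs_mul]
        exact mul_le_mul_of_nonneg_left (hy c (Finset.mem_range.1 hc)) (abs_nonneg _)
    _ = φ (∑ c ∈ Finset.range T.n, |mget A r c| * wIn c) := by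
        rw [map_sum]
        exact Finset.sum_congr rfl fun c _ => by rw [map_mul, map_abs hφ]
    _ ≤ φ (bound r) := hφ hrow

/-- **Soundness of the node check**: `checkNode = true` gives the per-node clauses a1–a20 of `Chain` for the
interpreted record, verbatim. [folklore] -/
theorem node_of_checkNode (hco : T.CoefOK φ) {j s : ℕ} (hN : T.checkNode j s = true) {d : CertData}
    (hd : d = T.toCertData φ) :
    d.Wsupp (d.x j s) ∧ (∀ n, d.Wsupp (d.P j s n)) ∧ 0 ≤ d.mC j s ∧ d.InBall j (d.x j s) (d.mC j s) ∧
      (∀ i k, 0 ≤ d.rP j s i k) ∧ 0 ≤ d.EI j s ∧ d.EI j s ≤ d.E j s ∧ d.E j s ≤ d.EO j s ∧ d.EO j s ≤ d.ρO j s ∧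
      d.E j s ≤ d.ρ j s ∧ d.ρ j s ≤ d.ρO j s ∧
      IsLinearMap ℝ (d.Cm j s) ∧ IsLinearMap ℝ (d.Ci j s) ∧
      (∀ v, d.Wsupp (d.Cm j s v) ∧ d.Wsupp (d.Ci j s v) ∧
        (d.Wsupp v → d.Ci j s (d.Cm j s v) = v ∧ d.Cm j s (d.Ci j s v) = v)) ∧
      (∀ ξ : (Fin 4 → ℤ → ℝ), (∀ i k, -d.Kb ≤ k → k ≤ d.Ka → |ξ i k| ≤ d.rP j s i k) →
        d.InBall j (d.Cm j s ξ) (d.ρ j s - d.E j s) ∧ d.InBall j (d.Cm j s ξ) (d.ρO j s - d.EO j s)) ∧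
      (0 ≤ d.NCi j s ∧ ∀ v : (Fin 4 → ℤ → ℝ), d.InBall j v 1 → ∀ i k, -d.Kb ≤ k → k ≤ d.Ka →
        |d.Ci j s v i k| ≤ d.NCi j s * d.rP j s i k) ∧
      d.P j s 0 = d.x j s ∧
      (∀ n, n < d.pdeg → ∀ i k, ((n : ℝ) + 1) * d.P j s (n + 1) i k =
        ∑ m' ∈ Finset.range (n + 1), d.Qb (d.P j s m') (d.P j s (n - m')) i k) ∧
      (∀ v i k, d.Wv j s 0 v i k = if -d.Kb ≤ k ∧ k ≤ d.Ka then v i k else 0) ∧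
      (∀ n, n < d.pdeg → ∀ v i k, ((n : ℝ) + 1) * d.Wv j s (n + 1) v i k =
        ∑ m' ∈ Finset.range (n + 1), (d.Qb (d.P j s m') (d.Wv j s (n - m') v) i k +
          d.Qb (d.Wv j s (n - m') v) (d.P j s m') i k)) := by
  subst hd
  simp only [checkNode, Bool.and_eq_true, decide_eq_true_eq] at hN
  obtain ⟨⟨⟨⟨⟨⟨⟨⟨⟨⟨⟨⟨⟨⟨⟨⟨⟨⟨hmC, hx⟩, hrP⟩, hEI⟩, hEIE⟩, hEEO⟩, hEOρO⟩, hEρ⟩, hρρO⟩, hCiCm⟩, hCmCi⟩,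
    hPar⟩, hParO⟩, hNCi⟩, hNCirow⟩, hP0⟩, hjet⟩, hW0⟩, hvar⟩ := hN
  have hφ0 : ∀ {a : K}, 0 ≤ a → (0 : ℝ) ≤ φ a := fun ha => by simpa using hφ ha
  -- coordinate forms of the two box hypotheses used below
  have boxRP : ∀ ξ : (Fin 4 → ℤ → ℝ), (∀ i k, -T.Kb ≤ k → k ≤ T.Ka → |ξ i k| ≤ (T.toCertData φ).rP j s i k) →
      ∀ c < T.n, |T.wv ξ c| ≤ φ (vget (T.node j s).rP c) := fun ξ hξ => (T.box_iff φ _ ξ).1 hξ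
  refine ⟨fun i k hk => T.vecR_off φ _ i hk, fun n i k hk => T.vecR_off φ _ i hk, hφ0 hmC, ?_, ?_, hφ0 hEI,
    hφ hEIE, hφ hEEO, hφ hEOρO, hφ hEρ, hφ hρρO, T.isLinearMap_linR φ _, T.isLinearMap_linR φ _, ?_, ?_, ⟨hφ0 hNCi, ?_⟩,
    ?_, ?_, ?_, ?_⟩
  · -- a4: `|x| ≤ mC ω`
    rw [toCertData_x, T.inBall_iff φ]
    intro c hc
    rw [T.wv_vecR φ _ hc, ← map_abs hφ, toCertData_mC, ← map_mul]
    exact hφ (of_decide_eq_true ((allN_eq_true.1 hx) c hc))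
  · -- a5: `rP ≥ 0`
    intro i k
    rw [toCertData_rP, T.vecR_apply]
    split_ifs with hk
    · exact hφ0 (of_decide_eq_true ((allN_eq_true.1 hrP) _ (T.idx_lt_n i hk)))
    · exact le_rfl
  · -- a14: window support of the frames and the exact inverses
    intro v
    refine ⟨T.wsupp_linR φ _ v, T.wsupp_linR φ _ v, fun hv => ⟨?_, ?_⟩⟩
    · rw [toCertData_Ci, toCertData_Cm, ← T.linR_mulMatN φ, T.linR_congr φ ((T.matEq_eq_true).1 hCiCm), T.linR_idMat φ]
      exact trunc_eq_self (T.toCertData φ) hv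
    · rw [toCertData_Ci, toCertData_Cm, ← T.linR_mulMatN φ, T.linR_congr φ ((T.matEq_eq_true).1 hCmCi), T.linR_idMat φ]
      exact trunc_eq_self (T.toCertData φ) hv
  · -- a15: the two parallelepiped bounds
    intro ξ hξ
    have hc := boxRP ξ hξ
    refine ⟨(T.inBall_iff φ j _ _).2 fun r hr => ?_, (T.inBall_iff φ j _ _).2 fun r hr => ?_⟩
    · have := T.abs_wv_linR_le hφ hPar hc hr
      rwa [map_mul, map_sub] at this
    · have := T.abs_wv_linR_le hφ hParO hc hr
      rwa [map_mul, map_sub] at this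
  · -- a16: the `NCi` bound
    intro v hv i k hk1 hk2
    have hk : -T.Kb ≤ k ∧ k ≤ T.Ka := ⟨hk1, hk2⟩
    have hc : ∀ c < T.n, |T.wv v c| ≤ φ (T.wgt j c) := by
      intro c hc
      have := (T.inBall_iff φ j v 1).1 hv c hc
      rwa [one_mul] at this
    have := T.abs_wv_linR_le hφ hNCirow hc (T.idx_lt_n i hk)
    rw [T.wv_idx _ i hk, map_mul] at this
    rwa [toCertData_Ci, toCertData_NCi, toCertData_rP, T.vecR_apply, if_pos hk]
  · -- a17: `P 0 = x`
    rw [toCertData_P, toCertData_x]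
    exact T.vecR_congr φ ((T.vecEq_eq_true).1 hP0)
  · -- a18: the jet recursion
    intro n hn i k
    have hq := (T.vecEq_eq_true).1 ((allN_eq_true.1 hjet) n hn)
    by_cases hk : -T.Kb ≤ k ∧ k ≤ T.Ka
    · have hlt := T.idx_lt_n i hk
      have e := congrArg φ (hq _ hlt)
      rw [vget_map_range _ hlt, map_mul, T.vget_foldr_addVecN _ _ hlt, map_sum] at e
      simp only [toCertData_P, T.Qb_vecR hco, T.vecR_apply, if_pos hk]
      simpa using e
    · simp only [toCertData_P, T.vecR_off φ _ i hk, mul_zero]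
      exact (Finset.sum_eq_zero fun m' _ => wsupp_Qb (T.toCertData φ) _ _ i k hk).symm
  · -- a19: `Wv 0 = trunc`
    intro v i k
    rw [toCertData_Wv, T.linR_congr φ ((T.matEq_eq_true).1 hW0), T.linR_idMat φ, trunc_apply]
  · -- a20: the variational-jet recursion
    intro n hn v i k
    have hq := (T.matEq_eq_true).1 ((allN_eq_true.1 hvar) n hn)
    have e := congrFun (congrFun (T.linR_congr φ hq v) i) k
    rw [T.linR_smulMatN φ, T.linR_foldr_addMatN φ] at e
    simp only [Pi.smul_apply, smul_eq_mul, map_add, map_natCast, map_one, Finset.sum_apply, T.linR_mulMatN φ,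
      T.linR_symQbMat hco, Pi.add_apply] at e
    simpa only [toCertData_Wv, toCertData_P] using e

end Node

end CertTables

end Summit.NavierStokesRegularity.NavierStokesRegularity.Theorems.TaylorModelCert
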